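import Literature.NumberTheory.Transcendental.KZProductIdeal
import Literature.NumberTheory.Transcendental.KZLogCalculusProofs

/-!
# `NormalFormPrinciple` (stmt-KontsevichZagierPeriods-3869), line `SketchIdeator1` — stub `stub_signKernelRep`

Existence of the SIGN-KERNEL representation. For an integral representation `r = [D, g]` in
dimension `n` (Kontsevich–Zagier 2001, §1.1: `D ⊆ ℝⁿ` `ℚ`-semialgebraic, `g` `ℚ`-semialgebraic and
absolutely integrable on `D`) and a polynomial `Q ∈ ℚ[x₁, …, xₙ]`, the pair
`ρ = [{x ∈ D | Q(x) ≠ 0} × [0,1], g(x) · Q(x)/(Q(x)²(1−u)² + u²)]` (`u` the last coordinate) is again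
an integral representation:

* the band `{x ∈ D | Q(x) ≠ 0} × [0,1]` is `ℚ`-semialgebraic (`KZlog.isSemialgebraic_band`);
* the integrand is `ℚ`-semialgebraic on the band: `g ∘ init` is, and the kernel is the quotient of the
  two polynomials `Q(init z)` and `Q(init z)²(1 − z_last)² + z_last²`, whose denominator does not
  vanish on the band (`Q ≠ 0` there);
* it is absolutely integrable (Tonelli along the last coordinate,
  `KZlog.integrableOn_band_of_lintegral_fibre_le`): for `q ≠ 0` the fibre integral is EXACT,
  `∫₀¹ |q| du/(q²(1−u)²+u²) = arctan(1/|q|) + arctan |q| = π/2 ≤ 2` (primitive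
  `arctan(((1+q²)u − q²)/|q|)`), so the fibre integrals are bounded by `2|g|`, integrable on `D`.

This is the representation whose fibre integral is `(π/2)·sgn Q(x)·g(x)`: the sign-kernel step of the
line ("one strict inequality of the domain is sold for one rational factor at the price of one `[π]`").
Sources: Kontsevich–Zagier 2001, §1.1–1.2 (definition of effective periods, the "more variables"
device); the computation is folklore calculus.
-/

noncomputable section

open MeasureTheory Set
open Literature.NumberTheory.Transcendental Literature.NumberTheory.Transcendental.KZ
open Literature.ModelTheory.ExponentialFields (IsSemialgebraic)

namespace Summit.KontsevichZagierPeriods.HurwitzMicroSectors.NormalFormPrinciple.PiBox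

namespace stub_signKernelRepAux

/-- The denominator of the sign kernel is positive: `q²(1−t)² + t² > 0` for `q ≠ 0`. [folklore] -/
theorem den_pos {q : ℝ} (hq : q ≠ 0) (t : ℝ) : 0 < q ^ 2 * (1 - t) ^ 2 + t ^ 2 := by
  rcases eq_or_ne t 0 with rfl | ht
  · ring_nf
    positivity
  · positivity

/-- The primitive of the sign kernel: `d/dt arctan(((1+a²)t − a²)/a) = a/(a²(1−t)² + t²)` for
`a ≠ 0`. [folklore] -/
theorem hasDerivAt_signKernel_primitive {a : ℝ} (ha : a ≠ 0) (t : ℝ) :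
    HasDerivAt (fun t : ℝ => Real.arctan (((1 + a ^ 2) * t - a ^ 2) / a))
      (a / (a ^ 2 * (1 - t) ^ 2 + t ^ 2)) t := by
  have h1 : HasDerivAt (fun t : ℝ => ((1 + a ^ 2) * t - a ^ 2) / a) ((1 + a ^ 2) / a) t := by
    simpa using (((hasDerivAt_id t).const_mul (1 + a ^ 2)).sub_const (a ^ 2)).div_const a
  convert h1.arctan using 1
  have hD : a ^ 2 * (1 - t) ^ 2 + t ^ 2 ≠ 0 := (den_pos ha t).ne'
  have hE : a ^ 2 + ((1 + a ^ 2) * t - a ^ 2) ^ 2 ≠ 0 := by positivity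
  field_simp
  ring

/-- The exact fibre integral of the sign kernel: `∫₀¹ |q| dt/(q²(1−t)² + t²) = π/2` for `q ≠ 0`
(`= arctan(1/|q|) + arctan |q|`). [folklore] -/
theorem integral_signKernel {q : ℝ} (hq : q ≠ 0) :
    ∫ t in (0 : ℝ)..1, |q| / (q ^ 2 * (1 - t) ^ 2 + t ^ 2) = Real.pi / 2 := by
  rw [← sq_abs q]
  have ha : 0 < |q| := abs_pos.mpr hq
  generalize |q| = a at ha ⊢
  have hint : IntervalIntegrable (fun t : ℝ => a / (a ^ 2 * (1 - t) ^ 2 + t ^ 2)) volume 0 1 :=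
    (continuous_const.div (by fun_prop) fun t => (den_pos ha.ne' t).ne').intervalIntegrable 0 1
  rw [intervalIntegral.integral_eq_sub_of_hasDerivAt
    (fun t _ => hasDerivAt_signKernel_primitive ha.ne' t) hint]
  have h1 : ((1 + a ^ 2) * 1 - a ^ 2) / a = a⁻¹ := by
    field_simp
    ring
  have h0 : ((1 + a ^ 2) * 0 - a ^ 2) / a = -a := by
    field_simp
    ring
  simp only [h1, h0, Real.arctan_neg, Real.arctan_inv_of_pos ha]
  ring

/-- The fibre bound of the sign-kernel integrand: `∫₀¹ ‖c · q/(q²(1−t)²+t²)‖ dt = |c|·π/2 ≤ ‖2c‖`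
for `q ≠ 0`. [folklore] -/
theorem lintegral_enorm_signKernel_le (c q : ℝ) (hq : q ≠ 0) :
    ∫⁻ t in Icc (0 : ℝ) 1, ‖c * (q / (q ^ 2 * (1 - t) ^ 2 + t ^ 2))‖ₑ ≤ ‖2 * c‖ₑ := by
  have hD : ∀ t : ℝ, 0 < q ^ 2 * (1 - t) ^ 2 + t ^ 2 := den_pos hq
  have h1 : EqOn (fun t : ℝ => ‖c * (q / (q ^ 2 * (1 - t) ^ 2 + t ^ 2))‖ₑ)
      (fun t => ENNReal.ofReal (|c| * (|q| / (q ^ 2 * (1 - t) ^ 2 + t ^ 2)))) (Icc 0 1) :=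
    fun t _ => by
      simp only
      rw [← ofReal_norm, norm_mul, norm_div, Real.norm_eq_abs, Real.norm_eq_abs, Real.norm_eq_abs,
        abs_of_pos (hD t)]
  have hcont : Continuous fun t : ℝ => |c| * (|q| / (q ^ 2 * (1 - t) ^ 2 + t ^ 2)) :=
    continuous_const.mul (continuous_const.div (by fun_prop) fun t => (hD t).ne')
  rw [setLIntegral_congr_fun measurableSet_Icc h1,
    ← ofReal_integral_eq_lintegral_ofReal hcont.integrableOn_Icc
      ((ae_restrict_mem measurableSet_Icc).mono fun t _ => by have := hD t; positivity),
    integral_Icc_eq_integral_Ioc, ← intervalIntegral.integral_of_le zero_le_one,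
    intervalIntegral.integral_const_mul, integral_signKernel hq, ← ofReal_norm, norm_mul,
    Real.norm_eq_abs, Real.norm_eq_abs, abs_two]
  exact ENNReal.ofReal_le_ofReal (by nlinarith [Real.pi_le_four, abs_nonneg c])

/-- Semialgebraicity of the sign-kernel integrand `g(init z) · Q(init z)/(Q(init z)²(1−u)²+u²)` on
the band `{x ∈ S} × [0,1]` when `Q ≠ 0` on `S`: `g ∘ init` is semialgebraic, the kernel is a
quotient of polynomials with non-vanishing denominator. [cite: BochnakCosteRoy1998, Prop. 2.2.6] -/
theorem isSemialgebraicFunOn_signKernel {n : ℕ} {S : Set (Fin n → ℝ)} {g : (Fin n → ℝ) → ℝ}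
    (Q : MvPolynomial (Fin n) ℚ) (hS : IsSemialgebraic ℚ S) (hg : IsSemialgebraicFunOn ℚ S g)
    (hQ : ∀ x ∈ S, MvPolynomial.aeval x Q ≠ 0) :
    IsSemialgebraicFunOn ℚ (KZlog.band S (fun _ => 0) (fun _ => 1))
      (fun z => g (Fin.init z) * (MvPolynomial.aeval (Fin.init z) Q /
        ((MvPolynomial.aeval (Fin.init z) Q) ^ 2 * (1 - z (Fin.last n)) ^ 2 + z (Fin.last n) ^ 2))) := by
  have hB : IsSemialgebraic ℚ (KZlog.band S (fun _ => (0 : ℝ)) (fun _ => 1)) :=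
    KZlog.isSemialgebraic_band (by simpa using isSemialgebraicFunOn_ratCast hS 0)
      (by simpa using isSemialgebraicFunOn_ratCast hS 1)
  have hgi := hg.comp_init_mono hB band_subset_setOf_init_mem
  have hinit : ∀ z : Fin (n + 1) → ℝ, z ∘ Fin.castSucc = Fin.init z := fun _ => rfl
  have hker : IsSemialgebraicFunOn ℚ (KZlog.band S (fun _ => (0 : ℝ)) (fun _ => 1))
      (fun z => MvPolynomial.aeval (Fin.init z) Q /
        ((MvPolynomial.aeval (Fin.init z) Q) ^ 2 * (1 - z (Fin.last n)) ^ 2 + z (Fin.last n) ^ 2)) := by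
    refine (isSemialgebraicFunOn_aeval_div_aeval hB (MvPolynomial.rename Fin.castSucc Q)
      ((MvPolynomial.rename Fin.castSucc Q) ^ 2 * (1 - MvPolynomial.X (Fin.last n)) ^ 2 +
        MvPolynomial.X (Fin.last n) ^ 2) fun z hz => ?_).congr fun z _ => ?_
    · simp only [map_add, map_mul, map_pow, map_sub, map_one, MvPolynomial.aeval_X,
        MvPolynomial.aeval_rename, hinit]
      exact (den_pos (hQ _ hz.1) _).ne'
    · simp only [map_add, map_mul, map_pow, map_sub, map_one, MvPolynomial.aeval_X,
        MvPolynomial.aeval_rename, hinit]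
  exact IsSemialgebraicFunOn.mul_holds hgi hker

end stub_signKernelRepAux

open stub_signKernelRepAux in
/-- **Sign-kernel representation exists**: for a representation `r = [D, g]` in dimension `n` and
a polynomial `Q`, the function `g(x) · Q(x)/(Q(x)²(1−u)² + u²)` is `ℚ`-semialgebraic and absolutely
integrable on the band `{x ∈ D, Q(x) ≠ 0} × [0,1]` (Tonelli: the fibre integral of
`|Q|/(Q²(1−u)²+u²)` over `[0,1]` is `π/2 ≤ 2` uniformly in `Q ≠ 0`), so that
`ρ = [{x ∈ D, Q ≠ 0} × [0,1], g·Q/(Q²(1−u)²+u²)]` is an integral representation in the sense of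
Kontsevich–Zagier. [folklore] -/
theorem stub_signKernelRep :
    ∀ (n : ℕ) (r : IntegralRep n) (Q : MvPolynomial (Fin n) ℚ),
    ∃ ρ : IntegralRep (n + 1),
      ρ.domain = KZlog.band {x | x ∈ r.domain ∧ MvPolynomial.aeval x Q ≠ 0} (fun _ => 0) (fun _ => 1) ∧
      ρ.integrand = (fun z => r.integrand (Fin.init z) *
        (MvPolynomial.aeval (Fin.init z) Q /
          ((MvPolynomial.aeval (Fin.init z) Q) ^ 2 * (1 - z (Fin.last n)) ^ 2 + z (Fin.last n) ^ 2))) := by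
  intro n r Q
  have hS : IsSemialgebraic ℚ {x | x ∈ r.domain ∧ MvPolynomial.aeval x Q ≠ 0} :=
    r.isSemialgebraic_domain.inter
      (Literature.ModelTheory.ExponentialFields.isSemialgebraic_setOf_eval_ne_zero Q)
  have hB : IsSemialgebraic ℚ
      (KZlog.band {x | x ∈ r.domain ∧ MvPolynomial.aeval x Q ≠ 0} (fun _ => (0 : ℝ)) (fun _ => 1)) :=
    KZlog.isSemialgebraic_band (by simpa using isSemialgebraicFunOn_ratCast hS 0)
      (by simpa using isSemialgebraicFunOn_ratCast hS 1)
  have hBm : MeasurableSet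
      (KZlog.band {x | x ∈ r.domain ∧ MvPolynomial.aeval x Q ≠ 0} (fun _ => (0 : ℝ)) (fun _ => 1)) :=
    IsSemialgebraic.measurableSet_holds hB
  have hW := isSemialgebraicFunOn_signKernel Q hS
    (r.isSemialgebraicFunOn_integrand.mono (fun x hx => hx.1) hS) fun x hx => hx.2
  refine ⟨⟨_, _, hB, hW, ?_⟩, rfl, rfl⟩
  refine KZlog.integrableOn_band_of_lintegral_fibre_le (IsSemialgebraic.measurableSet_holds hS) hBm
    (fun x t => KZlog.snoc_mem_band) (aestronglyMeasurable_of_isSemialgebraicFunOn hW hBm)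
    (K := fun x => 2 * r.integrand x) (fun x hx => ?_)
    ((r.integrableOn.mono_set fun x hx => hx.1).const_mul 2)
  simp only [Fin.init_snoc, Fin.snoc_last]
  exact lintegral_enorm_signKernel_le _ _ hx.2

end Summit.KontsevichZagierPeriods.HurwitzMicroSectors.NormalFormPrinciple.PiBox
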